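import Summits.QuantumFields.BalabanUV.Beta.FP.HorizontalBookkeepingTail

/-!
# `BalabanUV.Beta.FP.HorizontalRemainderFarFine` — road «FP» for binder row D1, organisation γ, row **RHOA-4c** «THE FAR-FINE PIECE IN (rem) CURRENCY»
# (owner erratum E-FP-7-3): the transport `N⁸·dressedEntry w (Π − truncK Π N) (N•v) a b` of the FAR-FINE piece `Π·𝟙[‖·‖∞ > N]` by EXPONENTIALLY localised
# weights obeys a POINTWISE n-free coarse letter `≤ B·‖v‖∞²e^{−(δ/2)‖v‖∞}`, hence the (rem) letter of the END of record `FP/HorizontalRemainderTotal` — log-FREE: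
# the tail's sup gain `(supNorm t)⁻⁶ ≤ N⁻⁶` and the weights' two ℓ¹ masses `∝ N⁻¹` pay the `N⁸` exactly ([folklore] lattice bookkeeping on `ℤ⁴`; nothing of the manuscripts)

HONEST DEPENDENCY (page 1, mandatory): continuum YM on T⁴ ⇐ BetaPertH ∧ nine spine estimates (0/9 proved); BetaPertH ⇐ (D1) ∧ (D4) ∧
CAP+tail; G-an2-4 gates asym, D1 and NE2/3/4.  HONEST FRAMING (cell contract, verbatim): «discharging `BetaPertH` makes Bałaban's UV
stability UNCONDITIONAL — a real constructive-QFT result; it is NOT the continuum limit and NOT the Clay problem.»  THIS MODULE is elementary [folklore]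
real analysis on `ℤ⁴` composed BY NAME from the tree: `DecimatedMomentSummable.dressedSum`, `DressedMomentNormalisation.dressedEntry`∕`EKer`,
`FP/HorizontalBookkeeping.truncK`, `FP/HorizontalBookkeepingTail.tail_apply`∕`letter_at_scale`∕`supNorm_natCast_smul` (beta-d1-formalise-leaf-02 g6),
`FP/TransportProfileMoments.summable_and_abs_tsum_le`, `LatticeConstantZl.Zl_le_elem`, `B12Sec2to5.l1`.  It cites nothing, defines nothing, mints no `Prop` fact,
0 sorry.  BOTH analytic inputs are HYPOTHESES displayed in every signature: the far-fine shape of `Π` (row RHOA-4 (b) ∕ IR-5′ ∕ IR-6 deliver it for the one-shot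
kernel `Π_n` — NOT here) and the exponential transport profile (row IPROF-UNIF ∕ IR-I — NOT here).  NOT (rem) for the NEAR-fine pieces (GAMMA-5∕6∕9, RHOA-6c′∕7,
GAMMA-7), NOT `hbook`, NOT D1, NOT BetaPertH, NOT continuum, NOT Clay.

ABSOLUTE RULE (cell charter, verbatim): «No internally-minted statement may enter as a cited fact. Every hypothesis is either kernel-proved in this
package or a verbatim quotation of a PUBLISHED theorem with page reference. The manuscript(s) under audit are NOT citable for their own disputed
steps — they are the thing under adjudication; programme-internal (2001/route/tribunal) claims are never citable.»

ROW (road FP OWNER b2b-balaban-beta-d1-p3 gen 7, E-FP-7-3 (i)): «for the far-fine piece `Jᵀ(Π_n·𝟙[‖·‖>N])J` via RHOA-4's fine letter `|Π_n(z)| ≤ C‖z‖⁻⁶e^{−δ‖z‖∕n}`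
+ the same J-contraction (NEW S-ROW «RHOA-4c: far-fine piece in (rem) currency», any seat; replaces (farT))».  Background (C-ne7bleaf10g25-1 ∕ F-gan24leaf01-g50-1 ∕
E-FP-7-3): the COARSE near∕far split of the γ-END is not n-free on the road — only the FINE split of `r = Π_n − K·𝟙[‖·‖ ≤ N]` is; this file is the far-FINE half.
LETTERS (displayed; `N ≥ 1`, `δ > 0` the weights' ℓ¹-rate): (Π-far) `∀ c e t, N < ‖t‖∞ → |Π c e t| ≤ C·‖t‖∞⁻⁶·e^{−(δ∕(2N))‖t‖∞}` — RHOA-4's shape at HALF the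
weights' rate (rates are monotone: `farLetter_mono_rate`; `(1 + ‖t‖∕N)^b` is absorbed upstream by `FarRegionMoment.poly_exp_le`); (w) `|w κ l x| ≤ (c∕N⁵)·e^{−(δ∕N)|x|₁}`.
CONTENT. §1 `farLetter_mono_rate`, `abs_farFine_le_exp` (the tail is `≤ (C∕N⁶)·e^{−(δ∕(2N))‖t‖∞}` EVERYWHERE — the sup gain),
`supNorm_nsmul_le_three` (`N‖v‖∞ ≤ ‖N•v + u − x‖∞ + |u|₁ + |x|₁`), `exp_coarse_shift_le` (`e^{−(a∕N)‖N•v+u−x‖∞} ≤ e^{−a‖v‖∞}·e^{(a∕N)|u|₁}·e^{(a∕N)|x|₁}`).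
§2 `halfRate_weight` (HALF the ℓ¹-decay pays the shift: `Σ'_u |w u|·e^{(δ∕(2N))|u|₁} ≤ c·β₀′·N⁻¹`, `β₀′ := e^{δ∕4}(1 + 8∕δ)⁴`), **`abs_dressedSum_farFine_le`**.
§3 **`sq_mul_abs_transportFar_le`** (POINTWISE, n-FREE: `‖v‖∞²·|N⁸·dressedEntry w (Π − truncK Π N) (N•v) a b| ≤ 16·C·c²·β₀′²·(‖v‖∞²·e^{−(δ∕2)‖v‖∞})`, powers
`N⁸·N⁻⁶·(N⁻¹)² = 1`).  §4 `tsum_sq_exp_supNorm_le`, **`rem_transportFar_le`** (`∀ S : Finset Pt, Σ_{v∈S} ‖v‖∞²·|…| ≤ 16·C·c²·β₀′²·(2·e^{δ∕16}·(16∕δ)²·(1 + 32∕δ)⁴)` =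
the shape `hrem` of `HorizontalRemainderTotal.abs_secondMoment_sub_window_le_of_remainder` VERBATIM), `rem_add`∕`rem_smul` (pieces add and scale in (rem) currency).
Provenance: unit `b2b-balaban-t4-ne7b-formalise-leaf-10` (gen 25, cross-cell duty NE7b → road FP), 2026-08-21; «not in print; our bookkeeping».  -/

noncomputable section

namespace Summit.QuantumFields.BalabanUV.Beta.FP.HorizontalRemainderFarFine

open Finset Filter Topology
open scoped BigOperators
open Literature.MathematicalPhysics.QuantumFieldTheory.Balaban1983to89
open Literature.MathematicalPhysics.QuantumFieldTheory.Balaban1983to89.Beta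
open B12Sec2to5 (l1 l1_nonneg abs_coord_le_l1)
open ExpKernelCalculus (Site Zl Zl_pos)
open LatticeConstantZl (Zl_le_elem)
open DecimatedMomentSummable (dressedSum)
open DressedMomentNormalisation (EKer dressedEntry)
open DyadicShell (Pt supNorm natAbs_le_supNorm supNorm_le_iff exists_eq_supNorm)
open Summit.QuantumFields.BalabanUV.Beta.FP.HorizontalBookkeeping (truncK truncK_apply)
open Summit.QuantumFields.BalabanUV.Beta.FP.HorizontalBookkeepingTail (tail_apply letter_at_scale supNorm_natCast_smul)
open Summit.QuantumFields.BalabanUV.Beta.FP.TransportProfileMoments (summable_and_abs_tsum_le)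

/-! ## §1 Scalar and geometric helpers -/

/-- [folklore] RATES ARE MONOTONE: a far letter at rate `a` implies the far letter at any smaller rate `a' ≤ a` (`0 ≤ a'`, `C ≥ 0` forced on the tail). -/
theorem farLetter_mono_rate {P : EKer 4} {C a a' : ℝ} {N : ℕ} (hC : 0 ≤ C) (ha' : a' ≤ a)
    (hP : ∀ c e (t : Pt), N < supNorm t → |P c e t| ≤ C / (supNorm t : ℝ) ^ 6 * Real.exp (-(a / N) * (supNorm t : ℝ))) :
    ∀ c e (t : Pt), N < supNorm t → |P c e t| ≤ C / (supNorm t : ℝ) ^ 6 * Real.exp (-(a' / N) * (supNorm t : ℝ)) := by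
  intro c e t ht
  refine (hP c e t ht).trans (mul_le_mul_of_nonneg_left (Real.exp_le_exp.mpr ?_) (by positivity))
  have hs : (0 : ℝ) ≤ supNorm t := Nat.cast_nonneg _
  have hN : (0 : ℝ) ≤ N := Nat.cast_nonneg _
  have : a' / N * (supNorm t : ℝ) ≤ a / N * (supNorm t : ℝ) :=
    mul_le_mul_of_nonneg_right (div_le_div_of_nonneg_right ha' hN) hs
  linarith

/-- [folklore] **THE SUP GAIN OF THE FAR-FINE PIECE**: under (Π-far) the tail kernel `Π − truncK Π N` is bounded EVERYWHERE by `(C∕N⁶)·e^{−(a∕N)‖t‖∞}`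
(zero on the core `‖t‖∞ ≤ N`; `‖t‖∞⁻⁶ ≤ N⁻⁶` beyond). -/
theorem abs_farFine_le_exp {P : EKer 4} {C a : ℝ} {N : ℕ} (hN : 1 ≤ N) (hC : 0 ≤ C)
    (hP : ∀ c e (t : Pt), N < supNorm t → |P c e t| ≤ C / (supNorm t : ℝ) ^ 6 * Real.exp (-(a / N) * (supNorm t : ℝ)))
    (c e : Fin 4) (t : Pt) :
    |(P - truncK P N) c e t| ≤ C / (N : ℝ) ^ 6 * Real.exp (-(a / N) * (supNorm t : ℝ)) := by
  rw [tail_apply]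
  split_ifs with h
  · rw [abs_zero]; positivity
  · have hlt : N < supNorm t := not_le.mp h
    have hNt : (N : ℝ) ≤ (supNorm t : ℝ) := by exact_mod_cast hlt.le
    have hN0 : (0 : ℝ) < N := by exact_mod_cast hN
    refine (hP c e t hlt).trans (mul_le_mul_of_nonneg_right ?_ (Real.exp_pos _).le)
    exact div_le_div_of_nonneg_left hC (by positivity) (pow_le_pow_left₀ hN0.le hNt 6)

/-- [folklore] THE THREE-POINT SPLIT OF THE COARSE OFFSET: `N·‖v‖∞ ≤ ‖N•v + u − x‖∞ + |u|₁ + |x|₁`. -/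
theorem supNorm_nsmul_le_three (N : ℕ) (v u x : Pt) :
    (N : ℝ) * (supNorm v : ℝ) ≤ (supNorm ((N : ℤ) • v + u - x) : ℝ) + l1 u + l1 x := by
  -- integer-valued triangle inequality `‖y‖∞ ≤ ‖y + u − x‖∞ + ‖u‖∞ + ‖x‖∞`, then `‖·‖∞ ≤ |·|₁`
  have htri : supNorm ((N : ℤ) • v) ≤ supNorm ((N : ℤ) • v + u - x) + supNorm u + supNorm x := by
    rw [supNorm_le_iff]
    intro i
    have h1 := natAbs_le_supNorm ((N : ℤ) • v + u - x) i
    have h2 := natAbs_le_supNorm u i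
    have h3 := natAbs_le_supNorm x i
    have e : ((N : ℤ) • v) i = ((N : ℤ) • v + u - x) i + x i - u i := by
      simp only [Pi.sub_apply, Pi.add_apply]; ring
    rw [e]
    have := Int.natAbs_add_le (((N : ℤ) • v + u - x) i + x i) (-(u i))
    have := Int.natAbs_add_le (((N : ℤ) • v + u - x) i) (x i)
    rw [Int.natAbs_neg] at *
    rw [sub_eq_add_neg]
    omega
  have hcast : ((supNorm ((N : ℤ) • v) : ℕ) : ℝ) ≤ (supNorm ((N : ℤ) • v + u - x) : ℝ) + (supNorm u : ℝ) + (supNorm x : ℝ) := by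
    exact_mod_cast htri
  rw [supNorm_natCast_smul] at hcast
  push_cast at hcast
  -- `‖·‖∞ ≤ |·|₁` (the tree's `LegPairingBounds.supNorm_le_l1`, inlined to keep the import cone at `HorizontalBookkeepingTail`)
  have hsl : ∀ y : Pt, (supNorm y : ℝ) ≤ l1 y := fun y => by
    obtain ⟨i, hi⟩ := exists_eq_supNorm y
    rw [← hi, Nat.cast_natAbs, Int.cast_abs]
    exact abs_coord_le_l1 y i
  linarith [hsl u, hsl x]

/-- [folklore] **THE KERNEL'S DECAY MOVED ONTO THE COARSE OFFSET**: for `a ≥ 0`, `N ≥ 1`,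
`e^{−(a∕N)‖N•v + u − x‖∞} ≤ e^{−a‖v‖∞}·e^{(a∕N)|u|₁}·e^{(a∕N)|x|₁}`. -/
theorem exp_coarse_shift_le {a : ℝ} {N : ℕ} (ha : 0 ≤ a) (hN : 1 ≤ N) (v u x : Pt) :
    Real.exp (-(a / N) * (supNorm ((N : ℤ) • v + u - x) : ℝ))
      ≤ Real.exp (-a * (supNorm v : ℝ)) * Real.exp (a / N * l1 u) * Real.exp (a / N * l1 x) := by
  rw [← Real.exp_add, ← Real.exp_add]
  refine Real.exp_le_exp.mpr ?_
  have hN0 : (0 : ℝ) < N := by exact_mod_cast hN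
  have h3 := supNorm_nsmul_le_three N v u x
  have haN : 0 ≤ a / N := div_nonneg ha hN0.le
  -- `−(a/N)·s ≤ −(a/N)·(N‖v‖ − |u|₁ − |x|₁)`
  have h1 : -(a / N) * (supNorm ((N : ℤ) • v + u - x) : ℝ) ≤ -(a / N) * ((N : ℝ) * (supNorm v : ℝ) - l1 u - l1 x) := by
    have : (N : ℝ) * (supNorm v : ℝ) - l1 u - l1 x ≤ (supNorm ((N : ℤ) • v + u - x) : ℝ) := by linarith
    nlinarith
  have e : -(a / N) * ((N : ℝ) * (supNorm v : ℝ) - l1 u - l1 x) = -a * (supNorm v : ℝ) + a / N * l1 u + a / N * l1 x := by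
    field_simp
    ring
  linarith

/-! ## §2 Half the ℓ¹-decay pays the shift; the scalar far-fine dressed sum -/

/-- [folklore] **HALF THE RATE PAYS THE SHIFT**: under the profile letter `|w x| ≤ (c∕N⁵)·e^{−(δ∕N)|x|₁}` the shifted weight
`x ↦ |w x|·e^{(δ∕(2N))|x|₁}` is summable with `Σ' ≤ c·(e^{δ∕4}·(1 + 8∕δ)⁴)·N⁻¹` (`letter_at_scale` at rate `δ∕2`, `k = 0`: mass `∝ N⁴` against `N⁻⁵`). -/
theorem halfRate_weight {w : Pt → ℝ} {c δ : ℝ} {N : ℕ} (hδ : 0 < δ) (hN : 1 ≤ N) (hc : 0 ≤ c)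
    (hw : ∀ x, |w x| ≤ c / (N : ℝ) ^ 5 * Real.exp (-(δ / N) * l1 x)) :
    Summable (fun x => |w x| * Real.exp (δ / (2 * N) * l1 x))
      ∧ ∑' x, |w x| * Real.exp (δ / (2 * N) * l1 x) ≤ c * (Real.exp (δ / 4) * (1 + 8 / δ) ^ 4) / N := by
  have hN0 : (0 : ℝ) < N := by exact_mod_cast hN
  have hc' : 0 ≤ c / (N : ℝ) ^ 5 := by positivity
  set g : Pt → ℝ := fun x => |w x| * Real.exp (δ / (2 * N) * l1 x) with hg
  -- the shifted weight obeys the profile letter at rate δ/2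
  have hgle : ∀ x, |g x| ≤ c / (N : ℝ) ^ 5 * Real.exp (-(δ / 2 / N) * l1 x) := by
    intro x
    have hg0 : 0 ≤ g x := mul_nonneg (abs_nonneg _) (Real.exp_pos _).le
    rw [abs_of_nonneg hg0, hg]
    calc |w x| * Real.exp (δ / (2 * N) * l1 x)
        ≤ (c / (N : ℝ) ^ 5 * Real.exp (-(δ / N) * l1 x)) * Real.exp (δ / (2 * N) * l1 x) :=
          mul_le_mul_of_nonneg_right (hw x) (Real.exp_pos _).le
      _ = c / (N : ℝ) ^ 5 * Real.exp (-(δ / 2 / N) * l1 x) := by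
          rw [mul_assoc, ← Real.exp_add]; congr 2; field_simp; ring
  have h := letter_at_scale (D := 4) (half_pos hδ) hN hc' hgle 0
  simp only [pow_zero, one_mul, Nat.factorial_zero, Nat.cast_one, mul_one, zero_add] at h
  obtain ⟨hs, hb⟩ := h
  have hs' : Summable g := by
    refine (Summable.congr hs fun x => ?_)
    exact abs_of_nonneg (mul_nonneg (abs_nonneg _) (Real.exp_pos _).le)
  refine ⟨hs', ?_⟩
  have e1 : ∑' x, g x = ∑' x, |g x| := tsum_congr fun x => (abs_of_nonneg (mul_nonneg (abs_nonneg _) (Real.exp_pos _).le)).symm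
  rw [e1]
  have e3 : Real.exp (δ / 2 / 2) = Real.exp (δ / 4) := by congr 1; ring
  have e4 : (1 : ℝ) + 4 / (δ / 2) = 1 + 8 / δ := by
    have hδ0 : δ ≠ 0 := hδ.ne'
    field_simp
    ring
  rw [e3, e4] at hb
  refine hb.trans (le_of_eq ?_)
  have hN1 : (N : ℝ) ≠ 0 := hN0.ne'
  field_simp

/-- [folklore] **THE SCALAR FAR-FINE DRESSED SUM**: a middle factor with `|T t| ≤ A·e^{−(a∕N)‖t‖∞}` (`A, a ≥ 0`) between patterns whose SHIFTED weights
`|w|·e^{(a∕N)|·|₁}`, `|w′|·e^{(a∕N)|·|₁}` are summable gives, at the coarse point `N•v`,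
`|dressedSum w T w′ (N•v)| ≤ A·e^{−a‖v‖∞}·(Σ'_u |w u|e^{(a∕N)|u|₁})·(Σ'_x |w′ x|e^{(a∕N)|x|₁})`. -/
theorem abs_dressedSum_farFine_le {w T w' : Pt → ℝ} {A a : ℝ} {N : ℕ} (hN : 1 ≤ N) (hA : 0 ≤ A) (ha : 0 ≤ a)
    (hT : ∀ t, |T t| ≤ A * Real.exp (-(a / N) * (supNorm t : ℝ)))
    (hw : Summable fun u => |w u| * Real.exp (a / N * l1 u)) (hw' : Summable fun x => |w' x| * Real.exp (a / N * l1 x))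
    (v : Pt) :
    |dressedSum w T w' ((N : ℤ) • v)|
      ≤ A * Real.exp (-a * (supNorm v : ℝ)) * (∑' u, |w u| * Real.exp (a / N * l1 u)) * (∑' x, |w' x| * Real.exp (a / N * l1 x)) := by
  set g : Pt → ℝ := fun u => |w u| * Real.exp (a / N * l1 u) with hg
  set g' : Pt → ℝ := fun x => |w' x| * Real.exp (a / N * l1 x) with hg'
  have hg0 : ∀ u, 0 ≤ g u := fun u => mul_nonneg (abs_nonneg _) (Real.exp_pos _).le
  have hg'0 : ∀ x, 0 ≤ g' x := fun x => mul_nonneg (abs_nonneg _) (Real.exp_pos _).le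
  -- the product majorant and its sum
  have hprod : HasSum (fun p : Pt × Pt => g p.1 * g' p.2) ((∑' u, g u) * (∑' x, g' x)) :=
    (hw.hasSum.mul hw'.hasSum) (hw.mul_of_nonneg hw' hg0 hg'0)
  have hmaj : HasSum (fun p : Pt × Pt => (A * Real.exp (-a * (supNorm v : ℝ))) * (g p.1 * g' p.2))
      ((A * Real.exp (-a * (supNorm v : ℝ))) * ((∑' u, g u) * (∑' x, g' x))) := hprod.mul_left _
  have hpt : ∀ p : Pt × Pt, ‖w p.1 * T ((N : ℤ) • v + p.1 - p.2) * w' p.2‖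
      ≤ (A * Real.exp (-a * (supNorm v : ℝ))) * (g p.1 * g' p.2) := by
    intro p
    rw [Real.norm_eq_abs, abs_mul, abs_mul]
    have hTp := hT ((N : ℤ) • v + p.1 - p.2)
    have hsh := exp_coarse_shift_le ha hN v p.1 p.2
    calc |w p.1| * |T ((N : ℤ) • v + p.1 - p.2)| * |w' p.2|
        ≤ |w p.1| * (A * Real.exp (-(a / N) * (supNorm ((N : ℤ) • v + p.1 - p.2) : ℝ))) * |w' p.2| := by
          gcongr
      _ ≤ |w p.1| * (A * (Real.exp (-a * (supNorm v : ℝ)) * Real.exp (a / N * l1 p.1) * Real.exp (a / N * l1 p.2))) * |w' p.2| := by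
          gcongr
      _ = (A * Real.exp (-a * (supNorm v : ℝ))) * (g p.1 * g' p.2) := by simp only [hg, hg']; ring
  have h := tsum_of_norm_bounded hmaj hpt
  unfold dressedSum
  rw [Real.norm_eq_abs] at h
  simpa only [mul_assoc] using h

/-! ## §3 The pointwise coarse letter of the transported far-fine piece, n-free -/

section Transport

variable {P w : EKer 4} {C c δ : ℝ} {N : ℕ}

/-- [folklore] **THE TRANSPORTED FAR-FINE PIECE, POINTWISE** (no square): `|N⁸·dressedEntry w (Π − truncK Π N) (N•v) a b| ≤ 16·C·c²·β₀′²·e^{−(δ∕2)‖v‖∞}`,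
`β₀′ := e^{δ∕4}·(1 + 8∕δ)⁴` — powers of `N`: `N⁸·(C∕N⁶)·(cβ₀′∕N)² = C·c²·β₀′²`. -/
theorem abs_transportFar_le (hN : 1 ≤ N) (hδ : 0 < δ) (hc : 0 ≤ c) (hC : 0 ≤ C)
    (hP : ∀ c' e (t : Pt), N < supNorm t → |P c' e t| ≤ C / (supNorm t : ℝ) ^ 6 * Real.exp (-(δ / (2 * N)) * (supNorm t : ℝ)))
    (hw : ∀ κ l (x : Pt), |w κ l x| ≤ c / (N : ℝ) ^ 5 * Real.exp (-(δ / N) * l1 x)) (a b : Fin 4) (v : Pt) :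
    |(N : ℝ) ^ 8 * dressedEntry w (P - truncK P N) ((N : ℤ) • v) a b|
      ≤ 16 * C * c ^ 2 * (Real.exp (δ / 4) * (1 + 8 / δ) ^ 4) ^ 2 * Real.exp (-(δ / 2) * (supNorm v : ℝ)) := by
  have hN0 : (0 : ℝ) < N := by exact_mod_cast hN
  set β : ℝ := Real.exp (δ / 4) * (1 + 8 / δ) ^ 4 with hβ
  set T : EKer 4 := P - truncK P N with hT
  -- the tail kernel's sup gain, at rate a := δ/2 (so a/N = δ/(2N))
  have hTle : ∀ c' e (t : Pt), |T c' e t| ≤ C / (N : ℝ) ^ 6 * Real.exp (-(δ / 2 / N) * (supNorm t : ℝ)) := by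
    intro c' e t
    have h := abs_farFine_le_exp (a := δ / 2) hN hC (fun c' e t ht => by
      have := hP c' e t ht; rwa [show δ / (2 * N) = δ / 2 / N by rw [div_div]] at this) c' e t
    exact h
  -- the shifted weights, per entry
  have hW : ∀ κ l, (Summable fun x => |w κ l x| * Real.exp (δ / 2 / N * l1 x))
      ∧ ∑' x, |w κ l x| * Real.exp (δ / 2 / N * l1 x) ≤ c * β / N := by
    intro κ l
    have h := halfRate_weight hδ hN hc (hw κ l)
    rw [show δ / (2 * N) = δ / 2 / N by rw [div_div]] at h
    exact h
  -- per entry pair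
  have hfib : ∀ c' e, |dressedSum (w c' a) (T c' e) (w e b) ((N : ℤ) • v)|
      ≤ C / (N : ℝ) ^ 6 * Real.exp (-(δ / 2) * (supNorm v : ℝ)) * (c * β / N) * (c * β / N) := by
    intro c' e
    have h := abs_dressedSum_farFine_le (a := δ / 2) hN (by positivity) (by positivity) (hTle c' e) (hW c' a).1 (hW e b).1 v
    refine h.trans ?_
    have h0 : 0 ≤ C / (N : ℝ) ^ 6 * Real.exp (-(δ / 2) * (supNorm v : ℝ)) := by positivity
    have n0 : 0 ≤ ∑' x, |w e b x| * Real.exp (δ / 2 / N * l1 x) :=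
      tsum_nonneg fun x => mul_nonneg (abs_nonneg _) (Real.exp_pos _).le
    have m0 : 0 ≤ ∑' u, |w c' a u| * Real.exp (δ / 2 / N * l1 u) :=
      tsum_nonneg fun x => mul_nonneg (abs_nonneg _) (Real.exp_pos _).le
    have hcb : 0 ≤ c * β / N := m0.trans (hW c' a).2
    have h1 : C / (N : ℝ) ^ 6 * Real.exp (-(δ / 2) * (supNorm v : ℝ)) * (∑' u, |w c' a u| * Real.exp (δ / 2 / N * l1 u))
        ≤ C / (N : ℝ) ^ 6 * Real.exp (-(δ / 2) * (supNorm v : ℝ)) * (c * β / N) :=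
      mul_le_mul_of_nonneg_left (hW c' a).2 h0
    exact mul_le_mul h1 (hW e b).2 n0 (mul_nonneg h0 hcb)
  -- the sixteen entry pairs
  have h16 : |dressedEntry w T ((N : ℤ) • v) a b|
      ≤ 16 * (C / (N : ℝ) ^ 6 * Real.exp (-(δ / 2) * (supNorm v : ℝ)) * (c * β / N) * (c * β / N)) := by
    unfold dressedEntry
    refine (Finset.abs_sum_le_sum_abs _ _).trans ?_
    calc ∑ c', |∑ e, dressedSum (w c' a) (T c' e) (w e b) ((N : ℤ) • v)|
        ≤ ∑ _c' : Fin 4, 4 * (C / (N : ℝ) ^ 6 * Real.exp (-(δ / 2) * (supNorm v : ℝ)) * (c * β / N) * (c * β / N)) := by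
          refine Finset.sum_le_sum fun c' _ => (Finset.abs_sum_le_sum_abs _ _).trans ?_
          calc ∑ e, |dressedSum (w c' a) (T c' e) (w e b) ((N : ℤ) • v)|
              ≤ ∑ _e : Fin 4, C / (N : ℝ) ^ 6 * Real.exp (-(δ / 2) * (supNorm v : ℝ)) * (c * β / N) * (c * β / N) :=
                Finset.sum_le_sum fun e _ => hfib c' e
            _ = _ := by rw [Finset.sum_const, Finset.card_univ, Fintype.card_fin, nsmul_eq_mul]; norm_num
      _ = _ := by rw [Finset.sum_const, Finset.card_univ, Fintype.card_fin, nsmul_eq_mul]; norm_num; ring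
  rw [abs_mul, abs_of_nonneg (by positivity : (0 : ℝ) ≤ (N : ℝ) ^ 8)]
  refine (mul_le_mul_of_nonneg_left h16 (by positivity)).trans (le_of_eq ?_)
  have hN1 : (N : ℝ) ≠ 0 := hN0.ne'
  field_simp

/-- [folklore] **ROW RHOA-4c, POINTWISE — THE COARSE LETTER OF THE FAR-FINE PIECE, n-FREE**:
`‖v‖∞²·|N⁸·dressedEntry w (Π − truncK Π N) (N•v) a b| ≤ 16·C·c²·β₀′²·(‖v‖∞²·e^{−(δ∕2)‖v‖∞})`.  No window moment enters: the far-fine piece is log-free. -/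
theorem sq_mul_abs_transportFar_le (hN : 1 ≤ N) (hδ : 0 < δ) (hc : 0 ≤ c) (hC : 0 ≤ C)
    (hP : ∀ c' e (t : Pt), N < supNorm t → |P c' e t| ≤ C / (supNorm t : ℝ) ^ 6 * Real.exp (-(δ / (2 * N)) * (supNorm t : ℝ)))
    (hw : ∀ κ l (x : Pt), |w κ l x| ≤ c / (N : ℝ) ^ 5 * Real.exp (-(δ / N) * l1 x)) (a b : Fin 4) (v : Pt) :
    (supNorm v : ℝ) ^ 2 * |(N : ℝ) ^ 8 * dressedEntry w (P - truncK P N) ((N : ℤ) • v) a b|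
      ≤ 16 * C * c ^ 2 * (Real.exp (δ / 4) * (1 + 8 / δ) ^ 4) ^ 2
          * ((supNorm v : ℝ) ^ 2 * Real.exp (-(δ / 2) * (supNorm v : ℝ))) := by
  have h := abs_transportFar_le hN hδ hc hC hP hw a b v
  have h0 : (0 : ℝ) ≤ (supNorm v : ℝ) ^ 2 := by positivity
  calc (supNorm v : ℝ) ^ 2 * |(N : ℝ) ^ 8 * dressedEntry w (P - truncK P N) ((N : ℤ) • v) a b|
      ≤ (supNorm v : ℝ) ^ 2 * (16 * C * c ^ 2 * (Real.exp (δ / 4) * (1 + 8 / δ) ^ 4) ^ 2 * Real.exp (-(δ / 2) * (supNorm v : ℝ))) :=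
        mul_le_mul_of_nonneg_left h (by positivity)
    _ = _ := by ring

end Transport

/-! ## §4 The n-free lattice constant and the (rem) letter of the END of record -/

/-- [folklore] **THE LATTICE CONSTANT**: `v ↦ ‖v‖∞²·e^{−(δ∕2)‖v‖∞}` is summable on `ℤ⁴` with `Σ' ≤ 2·e^{δ∕16}·(16∕δ)²·(1 + 32∕δ)⁴`
(through `‖v‖∞ ≤ |v|₁ + 1` and `e^{−(δ∕2)‖v‖∞} ≤ e^{−(δ∕8)|v|₁}`, `TransportProfileMoments.summable_and_abs_tsum_le` at `k = 2`, `LatticeConstantZl.Zl_le_elem`). -/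
theorem tsum_sq_exp_supNorm_le {δ : ℝ} (hδ : 0 < δ) :
    Summable (fun v : Pt => (supNorm v : ℝ) ^ 2 * Real.exp (-(δ / 2) * (supNorm v : ℝ)))
      ∧ ∑' v : Pt, (supNorm v : ℝ) ^ 2 * Real.exp (-(δ / 2) * (supNorm v : ℝ))
          ≤ 2 * Real.exp (δ / 16) * (16 / δ) ^ 2 * (1 + 32 / δ) ^ 4 := by
  set f : Pt → ℝ := fun v => (supNorm v : ℝ) ^ 2 * Real.exp (-(δ / 2) * (supNorm v : ℝ)) with hf
  set p : Pt → ℝ := fun v => (l1 v + 1) ^ 2 with hp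
  set ω : Pt → ℝ := fun v => Real.exp (-(δ / 8) * l1 v) with hω
  have ha : 0 < δ / 8 := by positivity
  have hωle : ∀ v, |ω v| ≤ 1 * Real.exp (-(δ / 8) * l1 v) := fun v => by
    rw [hω, abs_of_pos (Real.exp_pos _), one_mul]
  have hple : ∀ v : Pt, |p v| ≤ (l1 v + 1) ^ 2 := fun v => by
    rw [hp, abs_of_nonneg (by positivity)]
  obtain ⟨hs, hb⟩ := summable_and_abs_tsum_le (D := 4) (k := 2) ha zero_le_one hωle hple
  -- pointwise domination `f ≤ p·ω`
  have hdom : ∀ v, f v ≤ p v * ω v := by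
    intro v
    have hs0 : (0 : ℝ) ≤ supNorm v := Nat.cast_nonneg _
    have hsl : (supNorm v : ℝ) ≤ l1 v := by
      obtain ⟨i, hi⟩ := exists_eq_supNorm v
      rw [← hi, Nat.cast_natAbs, Int.cast_abs]
      exact abs_coord_le_l1 v i
    have h1 : (supNorm v : ℝ) ^ 2 ≤ (l1 v + 1) ^ 2 :=
      pow_le_pow_left₀ hs0 (by linarith) 2
    -- `|v|₁ ≤ 4‖v‖∞` (the tree's `D1BFx.GluonLegTails.l1_le_four_mul_supNorm`, inlined to keep the import cone at `HorizontalBookkeepingTail`)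
    have hl4 : l1 v ≤ 4 * (supNorm v : ℝ) := by
      unfold l1
      have h : ∀ μ : Fin 4, |(v μ : ℝ)| ≤ (supNorm v : ℝ) := fun μ => by
        rw [← Int.cast_abs, Int.abs_eq_natAbs]
        exact_mod_cast natAbs_le_supNorm v μ
      calc ∑ μ, |(v μ : ℝ)| ≤ ∑ _μ : Fin 4, (supNorm v : ℝ) := Finset.sum_le_sum fun μ _ => h μ
        _ = 4 * (supNorm v : ℝ) := by rw [Finset.sum_const, Finset.card_univ, Fintype.card_fin, nsmul_eq_mul]; norm_num
    have h2 : Real.exp (-(δ / 2) * (supNorm v : ℝ)) ≤ Real.exp (-(δ / 8) * l1 v) :=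
      Real.exp_le_exp.mpr (by nlinarith [l1_nonneg v])
    exact mul_le_mul h1 h2 (Real.exp_pos _).le (by positivity)
  have hf0 : ∀ v, 0 ≤ f v := fun v => by positivity
  have hfs : Summable f := Summable.of_nonneg_of_le hf0 hdom hs
  refine ⟨hfs, ?_⟩
  have hpw0 : ∀ v, 0 ≤ p v * ω v := fun v => mul_nonneg (by positivity) (Real.exp_pos _).le
  calc ∑' v, f v ≤ ∑' v, p v * ω v := hfs.tsum_le_tsum hdom hs
    _ = |∑' v, p v * ω v| := (abs_of_nonneg (tsum_nonneg hpw0)).symm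
    _ ≤ 1 * (((Nat.factorial 2 : ℕ) : ℝ) * Real.exp (δ / 8 / 2) * (2 / (δ / 8)) ^ 2 * Zl 4 (δ / 8 / 2)) := by
        simpa only [mul_assoc] using hb
    _ ≤ 2 * Real.exp (δ / 16) * (16 / δ) ^ 2 * (1 + 32 / δ) ^ 4 := by
        have hZ : Zl 4 (δ / 8 / 2) ≤ (1 + 32 / δ) ^ 4 := by
          refine (Zl_le_elem (by positivity) 4).trans (le_of_eq ?_)
          have hδ0 : δ ≠ 0 := hδ.ne'
          congr 1
          field_simp
          ring
        have e1 : ((Nat.factorial 2 : ℕ) : ℝ) = 2 := by norm_num [Nat.factorial]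
        have e2 : Real.exp (δ / 8 / 2) = Real.exp (δ / 16) := by congr 1; ring
        have e3 : (2 / (δ / 8)) ^ 2 = (16 / δ) ^ 2 := by
          have hδ0 : δ ≠ 0 := hδ.ne'
          congr 1
          field_simp
          ring
        rw [one_mul, e1, e2, e3]
        exact mul_le_mul_of_nonneg_left hZ (by positivity)

/-- [folklore] **ROW RHOA-4c — THE (rem) LETTER OF THE END OF RECORD FOR THE FAR-FINE PIECE, n-FREE**: for every FINITE coarse window `S`,
`Σ_{v∈S} ‖v‖∞²·|N⁸·dressedEntry w (Π − truncK Π N) (N•v) a b| ≤ 16·C·c²·β₀′²·(2·e^{δ∕16}·(16∕δ)²·(1 + 32∕δ)⁴)`, `β₀′ = e^{δ∕4}(1 + 8∕δ)⁴` —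
VERBATIM the hypothesis shape `hrem` of `HorizontalRemainderTotal.abs_secondMoment_sub_window_le_of_remainder` for this piece of `T − Xtr`. -/
theorem rem_transportFar_le {P w : EKer 4} {C c δ : ℝ} {N : ℕ} (hN : 1 ≤ N) (hδ : 0 < δ) (hc : 0 ≤ c) (hC : 0 ≤ C)
    (hP : ∀ c' e (t : Pt), N < supNorm t → |P c' e t| ≤ C / (supNorm t : ℝ) ^ 6 * Real.exp (-(δ / (2 * N)) * (supNorm t : ℝ)))
    (hw : ∀ κ l (x : Pt), |w κ l x| ≤ c / (N : ℝ) ^ 5 * Real.exp (-(δ / N) * l1 x)) (a b : Fin 4) :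
    ∀ S : Finset Pt, ∑ v ∈ S, (supNorm v : ℝ) ^ 2 * |(N : ℝ) ^ 8 * dressedEntry w (P - truncK P N) ((N : ℤ) • v) a b|
      ≤ 16 * C * c ^ 2 * (Real.exp (δ / 4) * (1 + 8 / δ) ^ 4) ^ 2
          * (2 * Real.exp (δ / 16) * (16 / δ) ^ 2 * (1 + 32 / δ) ^ 4) := by
  intro S
  obtain ⟨hfs, hfb⟩ := tsum_sq_exp_supNorm_le hδ
  have hK : 0 ≤ 16 * C * c ^ 2 * (Real.exp (δ / 4) * (1 + 8 / δ) ^ 4) ^ 2 := by positivity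
  calc ∑ v ∈ S, (supNorm v : ℝ) ^ 2 * |(N : ℝ) ^ 8 * dressedEntry w (P - truncK P N) ((N : ℤ) • v) a b|
      ≤ ∑ v ∈ S, 16 * C * c ^ 2 * (Real.exp (δ / 4) * (1 + 8 / δ) ^ 4) ^ 2
          * ((supNorm v : ℝ) ^ 2 * Real.exp (-(δ / 2) * (supNorm v : ℝ))) :=
        Finset.sum_le_sum fun v _ => sq_mul_abs_transportFar_le hN hδ hc hC hP hw a b v
    _ = 16 * C * c ^ 2 * (Real.exp (δ / 4) * (1 + 8 / δ) ^ 4) ^ 2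
          * ∑ v ∈ S, (supNorm v : ℝ) ^ 2 * Real.exp (-(δ / 2) * (supNorm v : ℝ)) := by rw [Finset.mul_sum]
    _ ≤ 16 * C * c ^ 2 * (Real.exp (δ / 4) * (1 + 8 / δ) ^ 4) ^ 2
          * ∑' v : Pt, (supNorm v : ℝ) ^ 2 * Real.exp (-(δ / 2) * (supNorm v : ℝ)) :=
        mul_le_mul_of_nonneg_left (hfs.sum_le_tsum S fun v _ => by positivity) hK
    _ ≤ _ := mul_le_mul_of_nonneg_left hfb hK

/-- [folklore] THE ASSEMBLER'S ONE-LINER: pieces of the remainder ADD in (rem) currency —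
`Σ_S ‖v‖²|A v| ≤ B₁` and `Σ_S ‖v‖²|B v| ≤ B₂` for all finite `S` ⟹ `Σ_S ‖v‖²|A v + B v| ≤ B₁ + B₂`. -/
theorem rem_add {A B : Pt → ℝ} {B₁ B₂ : ℝ}
    (hA : ∀ S : Finset Pt, ∑ v ∈ S, (supNorm v : ℝ) ^ 2 * |A v| ≤ B₁)
    (hB : ∀ S : Finset Pt, ∑ v ∈ S, (supNorm v : ℝ) ^ 2 * |B v| ≤ B₂) :
    ∀ S : Finset Pt, ∑ v ∈ S, (supNorm v : ℝ) ^ 2 * |A v + B v| ≤ B₁ + B₂ := by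
  intro S
  calc ∑ v ∈ S, (supNorm v : ℝ) ^ 2 * |A v + B v|
      ≤ ∑ v ∈ S, ((supNorm v : ℝ) ^ 2 * |A v| + (supNorm v : ℝ) ^ 2 * |B v|) :=
        Finset.sum_le_sum fun v _ => by
          rw [← mul_add]; exact mul_le_mul_of_nonneg_left (abs_add_le _ _) (by positivity)
    _ ≤ B₁ + B₂ := by rw [Finset.sum_add_distrib]; exact add_le_add (hA S) (hB S)

/-- [folklore] … and SCALE: `Σ_S ‖v‖²|A v| ≤ B₁` ⟹ `Σ_S ‖v‖²|r·A v| ≤ |r|·B₁` (the assembler's normalisation constants). -/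
theorem rem_smul {A : Pt → ℝ} {B₁ : ℝ} (r : ℝ)
    (hA : ∀ S : Finset Pt, ∑ v ∈ S, (supNorm v : ℝ) ^ 2 * |A v| ≤ B₁) :
    ∀ S : Finset Pt, ∑ v ∈ S, (supNorm v : ℝ) ^ 2 * |r * A v| ≤ |r| * B₁ := by
  intro S
  have e : ∑ v ∈ S, (supNorm v : ℝ) ^ 2 * |r * A v| = |r| * ∑ v ∈ S, (supNorm v : ℝ) ^ 2 * |A v| := by
    rw [Finset.mul_sum]
    exact Finset.sum_congr rfl fun v _ => by rw [abs_mul]; ring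
  rw [e]
  exact mul_le_mul_of_nonneg_left (hA S) (abs_nonneg r)

end Summit.QuantumFields.BalabanUV.Beta.FP.HorizontalRemainderFarFine

end
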